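import Mathlib.GroupTheory.SpecificGroups.Alternating
import Mathlib.Algebra.BigOperators.Ring.Finset
import Mathlib.Algebra.BigOperators.Fin
import Mathlib.Data.Fintype.BigOperators
import Mathlib.Data.Int.Order.Units
import HarnessLib

/-!
# Helper `helper_vennEvenPerm` of line `prym-layer-stable-rank` for crux
`CongruenceShadows.ShadowsStandard` (item stmt-SmoothPoincare4-14593, route route-SmoothPoincare4-CongruenceShadows)

**Two triples of subsets of a finite set with the same Venn data and empty triple intersection differ
by an EVEN permutation.**
Let `A B : Fin 3 → Finset α` on a finite type `α` with `|A i| = |B i|`, `|A i ∩ A j| = |B i ∩ B j|`,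
`A 0 ∩ A 1 ∩ A 2 = ∅ = B 0 ∩ B 1 ∩ B 2` and `8 ≤ |α|`. Then some `σ ∈ alternatingGroup α` has
`σ(A i) = B i` for all `i`.

Proof. The membership vector `x ↦ (x ∈ A i)ᵢ : α → (Fin 3 → Bool)` has fibres (the `8` atoms of the
Boolean algebra generated by the `A i`) whose sizes are `±`-combinations of `|α|`, `|A i|`,
`|A i ∩ A j|`, `|A 0 ∩ A 1 ∩ A 2|` (expand `∏ᵢ (cᵢ + dᵢ·𝟙_{A i})` and sum over `α`); so the fibres of the
two membership-vector maps have equal sizes and the maps differ by a permutation `σ` of `α`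
(`Equiv.ofFiberEquiv`), which then carries each `A i` onto `B i`. If `σ` is odd: the all-`true`
vector is not attained (empty triple intersection), so the `≥ 8` points of `α` have `≤ 7` membership
vectors and two distinct points `x ≠ y` share one (pigeonhole); the transposition `(x y)` preserves
every `A i` and `σ · (x y)` is even and still carries `A i` onto `B i`.

Used by the line to turn "pairwise-equivalent shadows with the covering condition" in Hall
coordinates (subsets of the finite set of maximal normal overgroups of a maximal characteristic
level) into an even permutation of the coordinates.

The file declares theorems only (pure finite combinatorics over Mathlib; the membership vector of `x`
is written inline as `fun i => decide (x ∈ A i)` and the `ℤ`-valued indicator of `S` as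
`if x ∈ S then 1 else 0`).
-/

set_option linter.dupNamespace false

noncomputable section

namespace Summit.SmoothPoincare4.SmoothPoincare4.Theorems.ShadowsStandard.PrymLayerStableRank

variable {α : Type*} [DecidableEq α]

/-- The cardinality of a finset is the sum of its `0/1`-indicator over the ambient finite type.
[folklore] -/
theorem natCast_card_eq_sum_indicator [Fintype α] (S : Finset α) :
    ((S.card : ℕ) : ℤ) = ∑ x, (if x ∈ S then (1 : ℤ) else 0) := by
  rw [Finset.sum_boole]
  congr 2
  ext x
  simp

/-- Expansion of `∑ₓ ∏ᵢ (cᵢ + dᵢ·𝟙_{A i}(x))` through the Venn data of the triple `A`. [folklore] -/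
theorem sum_prod_affine_indicator [Fintype α] (A : Fin 3 → Finset α) (c d : Fin 3 → ℤ) :
    ∑ x, ∏ i, (c i + d i * (if x ∈ A i then (1 : ℤ) else 0)) =
      c 0 * c 1 * c 2 * (Fintype.card α : ℤ)
      + d 0 * c 1 * c 2 * ((A 0).card : ℤ) + c 0 * d 1 * c 2 * ((A 1).card : ℤ)
      + c 0 * c 1 * d 2 * ((A 2).card : ℤ)
      + d 0 * d 1 * c 2 * ((A 0 ∩ A 1).card : ℤ) + d 0 * c 1 * d 2 * ((A 0 ∩ A 2).card : ℤ)
      + c 0 * d 1 * d 2 * ((A 1 ∩ A 2).card : ℤ)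
      + d 0 * d 1 * d 2 * ((A 0 ∩ A 1 ∩ A 2).card : ℤ) := by
  have h1 : (Fintype.card α : ℤ) = ∑ _x : α, (1 : ℤ) := by simp
  rw [h1]
  simp only [natCast_card_eq_sum_indicator, Finset.mul_sum, ← Finset.sum_add_distrib]
  refine Finset.sum_congr rfl fun x _ => ?_
  simp only [Fin.prod_univ_three, Finset.mem_inter]
  by_cases h0 : x ∈ A 0 <;> by_cases h1 : x ∈ A 1 <;> by_cases h2 : x ∈ A 2 <;>
    simp [h0, h1, h2] <;> ring

/-- The fibre over `v` of the membership-vector map `x ↦ (x ∈ A i)ᵢ` has cardinality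
`∑ₓ ∏ᵢ (cᵢ + dᵢ·𝟙_{A i}(x))` with `(cᵢ, dᵢ) = (0, 1)` where `v i = true` and `(1, -1)` where
`v i = false`. [folklore] -/
theorem natCast_card_fiber_memVec [Fintype α] (A : Fin 3 → Finset α) (v : Fin 3 → Bool) :
    (((Finset.univ.filter fun x : α => (fun i => decide (x ∈ A i)) = v).card : ℕ) : ℤ) =
      ∑ x, ∏ i, ((if v i then (0 : ℤ) else 1) +
        (if v i then (1 : ℤ) else -1) * (if x ∈ A i then (1 : ℤ) else 0)) := by
  rw [Finset.natCast_card_filter]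
  refine Finset.sum_congr rfl fun x _ => ?_
  have hfac : ∀ i, ((if v i then (0 : ℤ) else 1) +
      (if v i then (1 : ℤ) else -1) * (if x ∈ A i then (1 : ℤ) else 0)) =
        if (decide (x ∈ A i) = v i) then 1 else 0 := by
    intro i
    cases v i <;> by_cases hx : x ∈ A i <;> simp [hx]
  have key : ((fun i => decide (x ∈ A i)) = v) ↔ ∀ i, decide (x ∈ A i) = v i := funext_iff
  simp only [hfac, Fintype.prod_boole]
  by_cases h : (fun i => decide (x ∈ A i)) = v
  · rw [if_pos h, if_pos (key.mp h)]
  · rw [if_neg h, if_neg (mt key.mpr h)]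

/-- Equal Venn data force equal fibre cardinalities of the two membership-vector maps. [folklore] -/
theorem card_fiber_memVec_eq [Fintype α] (A B : Fin 3 → Finset α)
    (hcard : ∀ i, (A i).card = (B i).card)
    (hinter : ∀ i j, (A i ∩ A j).card = (B i ∩ B j).card)
    (hA : A 0 ∩ A 1 ∩ A 2 = ∅) (hB : B 0 ∩ B 1 ∩ B 2 = ∅) (v : Fin 3 → Bool) :
    (Finset.univ.filter fun x : α => (fun i => decide (x ∈ A i)) = v).card =
      (Finset.univ.filter fun x : α => (fun i => decide (x ∈ B i)) = v).card := by
  have h := natCast_card_fiber_memVec A v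
  rw [sum_prod_affine_indicator, hA] at h
  have h' := natCast_card_fiber_memVec B v
  rw [sum_prod_affine_indicator, hB] at h'
  simp only [hcard, hinter] at h
  exact_mod_cast h.trans h'.symm

omit [DecidableEq α] in
/-- Two maps out of a finite type whose fibres have pairwise equal sizes differ by a permutation of
the domain. [folklore] -/
theorem exists_perm_comp_eq_of_card_fiber_eq {β : Type*} [Fintype α] [DecidableEq β]
    (f g : α → β)
    (h : ∀ b, (Finset.univ.filter fun x => f x = b).card =
      (Finset.univ.filter fun x => g x = b).card) :
    ∃ σ : Equiv.Perm α, ∀ x, g (σ x) = f x := by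
  have e : ∀ b, {x // f x = b} ≃ {x // g x = b} := fun b =>
    Fintype.equivOfCardEq (by rw [Fintype.card_subtype, Fintype.card_subtype]; exact h b)
  exact ⟨Equiv.ofFiberEquiv e, Equiv.ofFiberEquiv_map e⟩

/-- A permutation intertwining membership in `A i` and `B i` carries `A i` onto `B i`. [folklore] -/
theorem image_eq_of_mem_iff (S T : Finset α) (σ : Equiv.Perm α) (hσ : ∀ x, σ x ∈ T ↔ x ∈ S) :
    S.image σ = T := by
  ext y
  simp only [Finset.mem_image]
  constructor
  · rintro ⟨x, hx, rfl⟩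
    exact (hσ x).mpr hx
  · intro hy
    exact ⟨σ.symm y, (hσ _).mp (by simpa using hy), by simp⟩

/-- A transposition of two points with the same membership in `S` preserves membership in `S`.
[folklore] -/
theorem swap_mem_iff (S : Finset α) {x y : α} (hxy : x ∈ S ↔ y ∈ S) (z : α) :
    Equiv.swap x y z ∈ S ↔ z ∈ S := by
  rcases eq_or_ne z x with rfl | hzx
  · rw [Equiv.swap_apply_left]; exact hxy.symm
  rcases eq_or_ne z y with rfl | hzy
  · rw [Equiv.swap_apply_right]; exact hxy
  rw [Equiv.swap_apply_of_ne_of_ne hzx hzy]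

/-- **REGISTERED HELPER `helper_vennEvenPerm`**: two triples `A, B` of subsets of a finite type with
`|A i| = |B i|`, `|A i ∩ A j| = |B i ∩ B j|`, both triple intersections empty and at least `8` points
differ by an EVEN permutation: `∃ σ ∈ alternatingGroup α, ∀ i, σ(A i) = B i`. [folklore] -/
theorem helper_vennEvenPerm :
    ∀ (α : Type) [Fintype α] [DecidableEq α] (A B : Fin 3 → Finset α),
      (∀ i, (A i).card = (B i).card) → (∀ i j, (A i ∩ A j).card = (B i ∩ B j).card) →
      A 0 ∩ A 1 ∩ A 2 = ∅ → B 0 ∩ B 1 ∩ B 2 = ∅ → 8 ≤ Fintype.card α →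
      ∃ σ : Equiv.Perm α, σ ∈ alternatingGroup α ∧ ∀ i, (A i).image σ = B i := by
  intro α _ _ A B hcard hinter hA hB h8
  obtain ⟨σ, hσ⟩ := exists_perm_comp_eq_of_card_fiber_eq
    (fun x : α => fun i => decide (x ∈ A i)) (fun x : α => fun i => decide (x ∈ B i))
    (card_fiber_memVec_eq A B hcard hinter hA hB)
  -- `σ` intertwines membership in `A i` and `B i`
  have hmem : ∀ x i, σ x ∈ B i ↔ x ∈ A i := fun x i => by simpa using congrFun (hσ x) i
  by_cases hs : Equiv.Perm.sign σ = 1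
  · exact ⟨σ, Equiv.Perm.mem_alternatingGroup.mpr hs,
      fun i => image_eq_of_mem_iff (A i) (B i) σ fun x => hmem x i⟩
  -- pigeonhole: the all-`true` vector is not attained, so two distinct points share a vector
  have hmaps : Set.MapsTo (fun x : α => fun i => decide (x ∈ A i)) (↑(Finset.univ : Finset α))
      (↑((Finset.univ : Finset (Fin 3 → Bool)).erase fun _ => true)) := by
    intro x _
    simp only [Finset.coe_erase, Finset.coe_univ, Set.mem_sdiff, Set.mem_univ, true_and,
      Set.mem_singleton_iff]
    intro hx
    have h0 := congrFun hx 0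
    have h1 := congrFun hx 1
    have h2 := congrFun hx 2
    simp only [decide_eq_true_eq] at h0 h1 h2
    have hmem3 : x ∈ A 0 ∩ A 1 ∩ A 2 := by simp [h0, h1, h2]
    rw [hA] at hmem3
    simp at hmem3
  have hlt : ((Finset.univ : Finset (Fin 3 → Bool)).erase fun _ => true).card <
      (Finset.univ : Finset α).card := by
    rw [Finset.card_erase_of_mem (Finset.mem_univ _), Finset.card_univ, Finset.card_univ,
      Fintype.card_fun, Fintype.card_bool, Fintype.card_fin]
    omega
  obtain ⟨x, -, y, -, hxy, hv⟩ := Finset.exists_ne_map_eq_of_card_lt_of_maps_to hlt hmaps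
  have hvi : ∀ i, x ∈ A i ↔ y ∈ A i := fun i => by simpa using congrFun hv i
  refine ⟨σ * Equiv.swap x y, ?_, fun i => image_eq_of_mem_iff (A i) (B i) _ fun z => ?_⟩
  · rw [Equiv.Perm.mem_alternatingGroup, Equiv.Perm.sign_mul, Equiv.Perm.sign_swap hxy]
    rcases Int.units_eq_one_or (Equiv.Perm.sign σ) with h | h
    · exact absurd h hs
    · rw [h, Int.units_mul_self]
  · rw [Equiv.Perm.mul_apply, hmem, swap_mem_iff (A i) (hvi i)]

end Summit.SmoothPoincare4.SmoothPoincare4.Theorems.ShadowsStandard.PrymLayerStableRank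

end
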